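import Summits.CriticalPhenomena.PercolationContinuityZ3.Theorems.PercNearOneGluingNoHeavyQuantCatHullLeafRun
import HarnessLib

/-!
# QUANT lane R8, T-DEC: THE LEAF CHECK BY IN-KERNEL BISECTION — a deterministic split rule (largest influence on the absolute mean), a
# fuel-bounded search, and its soundness

builds on p205010 (kernel theorem, internal audit signed; external expert review pending)

Support file (`--supports stmt-CriticalPhenomena-4575`), QUANT lane census seat prim-quant-census-2 (gen 78).  Definitions + theorems; standard axioms,
no sorries.  Instead of replaying a stored kd-tree (`Tab.leafOK`), `Tab.leafSearch` bisects on its own: a box that fails `Tab.leafBoxOK` is split at the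
midpoint of the coordinate with the largest influence on the absolute mean `A` (the rule census-2 g78's offline verifier uses, so the offline node
counts bound the fuel), and `Tab.leafSearch_sound` / `Tab.leafSearchOK_sound` conclude as `Tab.leafOK_sound`.  [this work].  Nothing here is cited as a
published result.  The gluing rows served [cite: KozmaNitzan2024, Conjecture 3 (p. 15)]; product measure [cite: Grimmett1999, §1.3 p. 10].
-/

noncomputable section

namespace Summit.CriticalPhenomena.PercolationContinuityZ3.Theorems
namespace Quant
namespace LawDec
namespace Tab

/-- index of the first maximal element of a nonempty-headed list of scores (ties: earliest). [this work] -/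
def argmaxFirst : List ℚ → ℕ
  | [] => 0
  | x :: xs =>
    let r := xs.foldl (fun (acc : ℚ × ℕ × ℕ) v => if v > acc.1 then (v, acc.2.2, acc.2.2 + 1) else (acc.1, acc.2.1, acc.2.2 + 1)) (x, 0, 1)
    r.2.1

/-- **the split rule**: `0` = the `G`-interval, `i+1` = parameter `i`, by largest influence on `A` over the box (as the offline verifier). [this work] -/
def leafBoxSplit (sh : Shape) (y : ℚ) (B : Box) : ℕ :=
  let rs := fun v : ℚ × ℚ × ℚ => coef2 fun z => sh.rate z v.1 v.2.1 v.2.2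
  let Aof := fun (b : Bool × Bool × Bool) (G : ℚ) => let v := B.vert b.1 b.2.1 b.2.2; (rs v).1 * G + (rs v).2 * y
  let dG := (bits3.map fun b => |(rs (B.vert b.1 b.2.1 b.2.2)).1| * (B.g1 - B.g0)).foldr max 0
  let flip0 := fun (b : Bool × Bool × Bool) => ((true, b.2.1, b.2.2) : Bool × Bool × Bool)
  let flip1 := fun (b : Bool × Bool × Bool) => ((b.1, true, b.2.2) : Bool × Bool × Bool)
  let flip2 := fun (b : Bool × Bool × Bool) => ((b.1, b.2.1, true) : Bool × Bool × Bool)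
  let infl := fun (sel : Bool × Bool × Bool → Bool) (fl : Bool × Bool × Bool → Bool × Bool × Bool) =>
    ((bits3.filter fun b => !sel b).map fun b => max |Aof b B.g1 - Aof (fl b) B.g1| |Aof b B.g0 - Aof (fl b) B.g0|).foldr max 0
  argmaxFirst [dG, infl (fun b => b.1) flip0, infl (fun b => b.2.1) flip1, infl (fun b => b.2.2) flip2]

/-- **fuel-bounded bisection** with the split rule. [this work] -/
def leafSearch (sh : Shape) (Pu P0 P1 P2 Q0 Q1 Q2 : ℚ) (y : ℚ) (T : Tab) (k : ℕ) : ℕ → Box → Bool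
  | 0, B => leafBoxOK sh Pu P0 P1 P2 Q0 Q1 Q2 y T k B
  | fuel + 1, B => leafBoxOK sh Pu P0 P1 P2 Q0 Q1 Q2 y T k B ||
      (leafSearch sh Pu P0 P1 P2 Q0 Q1 Q2 y T k fuel (B.halves (leafBoxSplit sh y B)).1 &&
       leafSearch sh Pu P0 P1 P2 Q0 Q1 Q2 y T k fuel (B.halves (leafBoxSplit sh y B)).2)

/-- soundness of the search on a box. [this work] -/
theorem leafSearch_sound {sh : Shape} {Pu P0 P1 P2 Q0 Q1 Q2 y : ℚ} {T : Tab} {k : ℕ} {P : ℝ → (Fin 3 → ℝ) → Prop}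
    (hok : ∀ B, leafBoxOK sh Pu P0 P1 P2 Q0 Q1 Q2 y T k B = true → ∀ G t, B.mem G t → P G t) :
    ∀ (fuel : ℕ) (B : Box), leafSearch sh Pu P0 P1 P2 Q0 Q1 Q2 y T k fuel B = true → ∀ G t, B.mem G t → P G t
  | 0, B, h, G, t, hm => hok B h G t hm
  | fuel + 1, B, h, G, t, hm => by
    unfold leafSearch at h
    simp only [Bool.or_eq_true, Bool.and_eq_true] at h
    rcases h with h | ⟨h1, h2⟩
    · exact hok B h G t hm
    · rcases B.mem_halves (leafBoxSplit sh y B) hm with hm1 | hm2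
      · exact leafSearch_sound hok fuel _ h1 G t hm1
      · exact leafSearch_sound hok fuel _ h2 G t hm2

/-- **the leaf check for one shape over a whole table by bisection**: one search per `G`-strip. [this work] -/
def leafSearchOK (sh : Shape) (Pu P0 P1 P2 Q0 Q1 Q2 : ℚ) (y : ℚ) (T : Tab) (fuel : ℕ) : Bool :=
  (List.range (T.gb.length - 1)).all fun k => leafSearch sh Pu P0 P1 P2 Q0 Q1 Q2 y T k fuel (T.rootBox k)

/-- **SOUNDNESS OF THE LEAF CHECK BY BISECTION.** [this work] -/
theorem leafSearchOK_sound {sh : Shape} {Pu P0 P1 P2 Q0 Q1 Q2 y : ℚ} {T : Tab} {fuel : ℕ}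
    (h : leafSearchOK sh Pu P0 P1 P2 Q0 Q1 Q2 y T fuel = true) (hw : T.wf = true)
    {G : ℝ} (hG : 0 < G) (hg0 : ((T.gb.getD 0 0 : ℚ) : ℝ) ≤ G) (hg1 : G ≤ ((T.gb.getLast?.getD 0 : ℚ) : ℝ))
    {t : Fin 3 → ℝ} (ht : ∀ i, 0 ≤ t i ∧ t i ≤ 1)
    (hA1 : G * sh.rate ((y : ℝ) / G) (t 0) (t 1) (t 2) ≤ ((T.ab.getLast?.getD 0 : ℚ) : ℝ)) :
    G * sh.lhsG (Pu : ℝ) P0 P1 P2 Q0 Q1 Q2 ((y : ℝ) / G) (t 0) (t 1) (t 2) ≤ T.Z G (G * sh.rate ((y : ℝ) / G) (t 0) (t 1) (t 2)) := by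
  have hw' := hw
  unfold wf at hw'; simp only [Bool.and_eq_true, decide_eq_true_eq] at hw'
  obtain ⟨⟨⟨⟨⟨hlen, _⟩, _⟩, _⟩, _⟩, _⟩ := hw'
  set k := idx T.gb G with hk
  have hk2 : k + 2 ≤ T.gb.length := idx_lt _ _ hlen
  unfold leafSearchOK at h; rw [List.all_eq_true] at h
  have hrun := h k (List.mem_range.2 (by omega))
  have hmem : (T.rootBox k).mem G t := by
    refine ⟨getD_idx_le _ _ hg0, ?_, fun i => ?_⟩
    · show G ≤ ((T.gb.getD (k + 1) 0 : ℚ) : ℝ)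
      have := le_getD_idx_succ T.gb G hlen hg1
      have e1 : T.gb.getD (idx T.gb G + 1) 0 = T.gb.getD (k + 1) 0 := by rw [hk]
      rwa [e1] at this
    · show ((0 : ℚ) : ℝ) ≤ t i ∧ t i ≤ ((1 : ℚ) : ℝ)
      push_cast; exact ht i
  exact leafSearch_sound (P := fun G' t' => 0 < G' → G' * sh.rate ((y : ℝ) / G') (t' 0) (t' 1) (t' 2) ≤ ((T.ab.getLast?.getD 0 : ℚ) : ℝ) →
      G' * sh.lhsG (Pu : ℝ) P0 P1 P2 Q0 Q1 Q2 ((y : ℝ) / G') (t' 0) (t' 1) (t' 2) ≤ T.Z G' (G' * sh.rate ((y : ℝ) / G') (t' 0) (t' 1) (t' 2)))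
    (fun B hB G' t' hm hG' hA' => leafBox_sound sh Pu P0 P1 P2 Q0 Q1 Q2 hw hk2 hB hm hG' hA') fuel _ hrun G t hmem hG hA1

end Tab
end LawDec
end Quant
end Summit.CriticalPhenomena.PercolationContinuityZ3.Theorems
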